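import Summits.BirchSwinnertonDyer.BirchSwinnertonDyer.Theorems.PrintCf2RamifiedOffTYZEvenOmegaDictionaryTerms
import Summits.BirchSwinnertonDyer.BirchSwinnertonDyer.Theorems.PrintCf2RamifiedOffTYZEvenOmegaSilence
import Summits.BirchSwinnertonDyer.BirchSwinnertonDyer.Theorems.PrintCf2RamifiedOffTYZEvenOmegaMover
import HarnessLib

/-!
# Route `PrintCf2`, crux stmt-BirchSwinnertonDyer-20509 `RamifiedOffTYZOfFacts` — **THE EVEN Ω-IDENTITY `evenSquareFormMatrix = evenOmegaFormMatrix` PROVED**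
# (cell `bsd-print-cf2`, LEAD of 20509 g14, line `offtyz-v7`, cycle 15; kernel helpers `--supports stmt-BirchSwinnertonDyer-20509`)

LEAD g13's research statement `EvenOmegaMatrixIdentity` (crux workfile `Cruxes/RamifiedOffTYZOfFacts/Lines/offtyz_v7_EvenOmega.lean`: "for distinct odd
primes with `∏ pᵢ ≡ 3 (mod 4)` and all bit vectors, `EvenOmegaDefs.evenSquareFormMatrix p = EvenOmegaDefs.evenOmegaFormMatrix p`"; verified there
numerically on 10135 tuples) is a THEOREM: `evenSquareFormMatrix_eq_evenOmegaFormMatrix` (§4).  Proof = `Lines/offtyz_v7_EvenOmegaProof.md`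
(LEAD g14): both sides are `x_im·R₃(x) + x_im x_2·R₂ + x_2·R₁(x) + R₄(x)` (§1); the four coefficient identities are the landed abstract rows —
(i) = (★)₆ (`QFormIdentitySix`, LEAD g9) with the regime-free kernel line (LEAD g13), (ii) = `row_two_monskyMatrixEven`, (iii) = `row_three_identity`,
(iv) = `row_four_identity` — read through the census ↔ forest dictionary (`…EvenOmegaDictionary*`) (§2–§3).
CONSEQUENCES (§5, by the landed consumers `…EvenOmegaSilence` p747936 / `…EvenOmegaMover` p747937, whose only non-fact hypothesis this was):
`two_dvd_scriptL_even_allk_of_facts` — the EVEN-SECTOR LOWER HALF of C⁺ (`2 ∣ 𝓛(n)` on the whole even jump-one class, ALL `k`) modulo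
`tyz_cmPointRingClassFrobeniusValueData ∧ thm11 ∧ GZK`; `selmerEight_six_bsdp_two_allk_of_facts` — `#Sel₂(E_n) = 8 ⟹ BSD₂(E_n)` for EVERY square-free
`n ≡ 6 (8)` (Smith's `S(6)`, 100 %) modulo `tyz_cmPointRingClassFrobeniusValueData ∧ thm11`.  Both CONDITIONAL on published named facts (gate:
`conditional-result`).  BSD is not proved by any of this; C⁺ (item 23431: also the UPPER half, the odd residues, the special generators) and crux 20509 remain OPEN.

References: [cite: HeathBrown1994SelmerCongruentII, Appendix (Monsky), typescript p. 39 L10 – p. 41 L36]; [cite: TianYuanZhang2017, Thm. 1.1, §3.1, Thm. 3.6 (1)(2),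
proof of Lemma 3.21]; [cite: Chaiken1982, §2]; [cite: Stanley1999EC2, Cor. 5.1.6]; crux notes `Lines/offtyz_v7_EvenOmega.lean`, `…EvenOmegaProof.md`.
-/

noncomputable section

open scoped Classical

namespace Summit.BirchSwinnertonDyer.PrintCf2.QFormForest

open Matrix Finset Literature.LinearAlgebra.Matrix Literature.Combinatorics.Enumerative
open Literature.NumberTheory.EllipticCurves.Smith2016
open Literature.NumberTheory.EllipticCurves.HeathBrown1994 Literature.NumberTheory.EllipticCurves.HeathBrown1994.Families
open Literature.NumberTheory.EllipticCurves.MonskySelmerParity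
open Summit.BirchSwinnertonDyer.PrintCf2.QForm Summit.BirchSwinnertonDyer.PrintCf2.EvenOmegaDefs Summit.BirchSwinnertonDyer.PrintCf2.MoverAssembly

set_option autoImplicit false

section Identity
variable {k : ℕ} (p : Fin k → ℕ) (hp : ∀ i, (p i).Prime) (hodd : ∀ i, Odd (p i)) (hinj : Function.Injective p)

/-! ## §1 The even square form as `x_im·P₃ + x_im x_2·P₂ + x_2·P₁ + P₄` -/

omit hp hodd hinj in
/-- **Expansion of the even square form in `x_im`, `x_2`** (`x_2² = x_2`). [cite: TianYuanZhang2017, §3.1, Thm. 3.6 (1)(2), proof of Lemma 3.21] -/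
theorem evenSquareFormMatrix_expand (xim x2 : ZMod 2) (x : Fin k → ZMod 2) :
    evenSquareFormMatrix p xim x2 x =
      xim * ((∑ S : Finset (Fin k), if (∏ i ∈ Sᶜ, p i) % 8 = 1 then blockWeightOdd p Sᶜ * ∑ j ∈ S, blockKappaSix p S j * x j else 0) +
          ∑ T : Finset (Fin k), if (∏ i ∈ T, p i) % 8 = 5 then chainCoeff p T * ∑ j ∈ T, QForm.blockRho p T j * x j else 0) +
      xim * x2 * (∑ S : Finset (Fin k), if (∏ i ∈ Sᶜ, p i) % 8 = 1 then blockWeightOdd p Sᶜ * blockKappaSixInf p S else 0) +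
      x2 * (∑ S : Finset (Fin k), if (∏ i ∈ Sᶜ, p i) % 8 = 1 then
          blockWeightOdd p Sᶜ * ∑ j ∈ S, (blockKappaSix p S j + blockKappaSixInf p S) * x j else 0) +
      ((∑ S : Finset (Fin k), if (∏ i ∈ Sᶜ, p i) % 8 = 1 then
          blockWeightOdd p Sᶜ * ((1 + ∑ j ∈ S, x j) * ∑ j ∈ S, blockKappaSix p S j * x j) else 0) +
        ∑ T : Finset (Fin k), if (∏ i ∈ T, p i) % 8 = 5 then chainCoeff p T * ((1 + ∑ j ∈ T, x j) * ∑ j ∈ T, QForm.blockRho p T j * x j) else 0) := by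
  have hsq : ∀ u : ZMod 2, u * u = u := by decide
  have hx2 : x2 * x2 = x2 := hsq x2
  have hS : ∀ S : Finset (Fin k), (if (∏ i ∈ Sᶜ, p i) % 8 = 1 then blockWeightOdd p Sᶜ * (1 + xim + x2 + ∑ j ∈ S, x j) *
      (∑ j ∈ S, blockKappaSix p S j * x j + blockKappaSixInf p S * x2) else 0) =
      xim * (if (∏ i ∈ Sᶜ, p i) % 8 = 1 then blockWeightOdd p Sᶜ * ∑ j ∈ S, blockKappaSix p S j * x j else 0) +
      xim * x2 * (if (∏ i ∈ Sᶜ, p i) % 8 = 1 then blockWeightOdd p Sᶜ * blockKappaSixInf p S else 0) +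
      x2 * (if (∏ i ∈ Sᶜ, p i) % 8 = 1 then blockWeightOdd p Sᶜ * ∑ j ∈ S, (blockKappaSix p S j + blockKappaSixInf p S) * x j else 0) +
      (if (∏ i ∈ Sᶜ, p i) % 8 = 1 then blockWeightOdd p Sᶜ * ((1 + ∑ j ∈ S, x j) * ∑ j ∈ S, blockKappaSix p S j * x j) else 0) := by
    intro S
    have hsum : ∑ j ∈ S, (blockKappaSix p S j + blockKappaSixInf p S) * x j =
        ∑ j ∈ S, blockKappaSix p S j * x j + blockKappaSixInf p S * ∑ j ∈ S, x j := by
      rw [mul_sum, ← sum_add_distrib]; exact sum_congr rfl fun j _ => by ring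
    split_ifs
    · rw [hsum]; grind
    · ring
  have hT : ∀ T : Finset (Fin k), (if (∏ i ∈ T, p i) % 8 = 5 then chainCoeff p T * (1 + xim + ∑ j ∈ T, x j) *
      (∑ j ∈ T, QForm.blockRho p T j * x j) else 0) =
      xim * (if (∏ i ∈ T, p i) % 8 = 5 then chainCoeff p T * ∑ j ∈ T, QForm.blockRho p T j * x j else 0) +
      (if (∏ i ∈ T, p i) % 8 = 5 then chainCoeff p T * ((1 + ∑ j ∈ T, x j) * ∑ j ∈ T, QForm.blockRho p T j * x j) else 0) := by
    intro T; split_ifs <;> ring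
  rw [evenSquareFormMatrix, sum_congr rfl (fun S _ => hS S), sum_congr rfl (fun T _ => hT T)]
  simp only [sum_add_distrib, ← mul_sum]
  ring

/-! ## §2 The coefficient of `x_im x_2` (row (ii)) and of `x_2 x_j` (row (i)) -/

include hp hodd hinj in
/-- **Row (ii) in census coordinates**: `Σ_S [d_{Sᶜ} ≡ 1]·blockWeightOdd p Sᶜ·blockKappaSixInf p S = Σ_j t_j·(A_j + A′_j)`.
[cite: HeathBrown1994SelmerCongruentII, Appendix (Monsky), typescript p. 41 L20–L36] [cite: Chaiken1982, §2] -/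
theorem row_two_census (h3 : (∏ i, p i) % 4 = 3) :
    (∑ S : Finset (Fin k), if (∏ i ∈ Sᶜ, p i) % 8 = 1 then blockWeightOdd p Sᶜ * blockKappaSixInf p S else 0) =
      ∑ j, addLegendreSym (-1) (p j) *
        ((monskyMatrixEven p).adjugate (Sum.inl j) (Sum.inr j) + (monskyMatrixEven p).adjugate (Sum.inr j) (Sum.inl j)) := by
  have hp2 : ∀ i, p i ≠ 2 := ne_two_of_odd p hodd
  have hS : ∀ S : Finset (Fin k), (if (∏ i ∈ Sᶜ, p i) % 8 = 1 then blockWeightOdd p Sᶜ * blockKappaSixInf p S else 0) =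
      (∑ i ∈ S, addLegendreSym (-1) (p i)) *
        (lap (fun i j => legendreMatrix p i j) S (fun i => addLegendreSym (-1) (p i) + addLegendreSym 2 (p i))).det * coblockWeight p S := by
    intro S
    have hw := ite_blockWeightOdd_compl_eq p hp hodd hinj h3 S
    rw [← blockKappaSixInf_eq_det_lap p hp hodd S, mul_assoc, mul_comm _ (coblockWeight p S), ← mul_assoc,
      show coblockWeight p S = blockWeightOdd p Sᶜ from rfl, ← hw]
    split_ifs <;> ring
  rw [Fintype.sum_congr _ _ hS, ← Finset.powerset_univ, row_two_monskyMatrixEven p hp hp2 hinj (Summit.BirchSwinnertonDyer.Rank1Residual.P2.AokiMonsky.sum_eps_eq_one_of_prod_mod_four p hodd h3)]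
  exact Fintype.sum_congr _ _ fun j => by ring

include hp hodd hinj in
/-- **Row (i) in census coordinates** ((★)₆ + the regime-free kernel line): `Σ_S [d_{Sᶜ} ≡ 1]·blockWeightOdd p Sᶜ·Σ_{j∈S}(κ^S_j + κ^S_∞) x_j = Σ_j A_j x_j`.
[cite: HeathBrown1994SelmerCongruentII, Appendix (Monsky), typescript p. 41 L20–L36] [cite: Chaiken1982, §2] -/
theorem row_one_census (h3 : (∏ i, p i) % 4 = 3) (x : Fin k → ZMod 2) :
    (∑ S : Finset (Fin k), if (∏ i ∈ Sᶜ, p i) % 8 = 1 then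
        blockWeightOdd p Sᶜ * ∑ j ∈ S, (blockKappaSix p S j + blockKappaSixInf p S) * x j else 0) =
      ∑ j, (monskyMatrixEven p).adjugate (Sum.inl j) (Sum.inr j) * x j := by
  have hp2 : ∀ i, p i ≠ 2 := ne_two_of_odd p hodd
  -- each summand in ambient form, then exchange the sums
  have hS : ∀ S : Finset (Fin k), (if (∏ i ∈ Sᶜ, p i) % 8 = 1 then
      blockWeightOdd p Sᶜ * ∑ j ∈ S, (blockKappaSix p S j + blockKappaSixInf p S) * x j else 0) =
      ∑ j, if j ∈ S then (∑ i ∈ S, addLegendreSym (-1) (p i)) *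
        (((lap (fun i j => legendreMatrix p i j) S (fun j => addLegendreSym (-1) (p j) + addLegendreSym 2 (p j))).updateCol j
          (fun r => if r ∈ S then addLegendreSym (-1) (p r) else 0)).det * coblockWeight p S) * x j else 0 := by
    intro S
    have hw := ite_blockWeightOdd_compl_eq p hp hodd hinj h3 S
    rw [← sum_filter, filter_mem_eq_inter, univ_inter]
    have hj : ∀ j ∈ S, (∑ i ∈ S, addLegendreSym (-1) (p i)) *
        (((lap (fun i j => legendreMatrix p i j) S (fun j => addLegendreSym (-1) (p j) + addLegendreSym 2 (p j))).updateCol j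
          (fun r => if r ∈ S then addLegendreSym (-1) (p r) else 0)).det * coblockWeight p S) * x j =
        (∑ i ∈ S, addLegendreSym (-1) (p i)) * blockWeightOdd p Sᶜ * ((blockKappaSix p S j + blockKappaSixInf p S) * x j) := by
      intro j hj
      rw [← blockKappaSix_add_inf_eq p hp hodd hj, show coblockWeight p S = blockWeightOdd p Sᶜ from rfl]; ring
    rw [sum_congr rfl hj, ← mul_sum, ← hw]
    split_ifs <;> ring
  rw [Fintype.sum_congr _ _ hS, Finset.sum_comm]
  refine Fintype.sum_congr _ _ fun j => ?_
  rw [adjugate_monskyMatrixEven_inl_inr_eq_sum_filter p hp hp2 hinj (Summit.BirchSwinnertonDyer.Rank1Residual.P2.AokiMonsky.sum_eps_eq_one_of_prod_mod_four p hodd h3) j, sum_mul, sum_filter,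
    ← Finset.powerset_univ]
  refine sum_congr rfl fun S _ => ?_
  by_cases hjS : j ∈ S
  · rw [if_pos hjS]
    by_cases h1 : ∑ m ∈ S, addLegendreSym (-1) (p m) = 1
    · rw [if_pos ⟨hjS, h1⟩, h1, one_mul]
    · have h0 : ∑ m ∈ S, addLegendreSym (-1) (p m) = 0 := by
        have h01 : ∀ u : ZMod 2, u ≠ 1 → u = 0 := by decide
        exact h01 _ h1
      rw [if_neg (fun h => h1 h.2), h0, zero_mul, zero_mul]
  · rw [if_neg hjS, if_neg (fun h => hjS h.1)]

/-! ## §3 The coefficient of `x_im x_j` (row (iii)) and of `x_a x_b` (row (iv)) -/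

omit hp hodd hinj in
/-- `Σ_i e_j(i)·f(i) = f(j)`. [folklore] -/
theorem sum_single_mul (j : Fin k) (f : Fin k → ZMod 2) : ∑ i, (Pi.single j (1 : ZMod 2) : Fin k → ZMod 2) i * f i = f j := by
  rw [Fintype.sum_congr _ _ (fun i => show (Pi.single j (1 : ZMod 2) : Fin k → ZMod 2) i * f i = if i = j then f i else 0 by
    rw [Pi.single_apply]; split_ifs <;> simp), Finset.sum_ite_eq' univ j, if_pos (mem_univ j)]

include hp hodd hinj in
/-- **The `x_im x_j`-coefficient of the even square form is `A_j + A′_j + G`** (row (iii) through the dictionary).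
[cite: TianYuanZhang2017, §3.1, Thm. 3.6 (1)(2)] [cite: HeathBrown1994SelmerCongruentII, Appendix (Monsky), typescript p. 41 L20–L36] [cite: Chaiken1982, §2] -/
theorem row_three_coeff (h3 : (∏ i, p i) % 4 = 3) (j : Fin k) :
    (∑ S : Finset (Fin k), if (∏ i ∈ Sᶜ, p i) % 8 = 1 then blockWeightOdd p Sᶜ * blockKappaSix p S j else 0) +
      (∑ T : Finset (Fin k), if (∏ i ∈ T, p i) % 8 = 5 then chainCoeff p T * QForm.blockRho p T j else 0) =
      (monskyMatrixEven p).adjugate (Sum.inl j) (Sum.inr j) + (monskyMatrixEven p).adjugate (Sum.inr j) (Sum.inl j) +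
        ∑ i, addLegendreSym (-1) (p i) * (monskyMatrixEven p).adjugate (Sum.inl i) (Sum.inr i) := by
  have hp2 : ∀ i, p i ≠ 2 := ne_two_of_odd p hodd
  have hrec : ∀ i j : Fin k, i ≠ j → legendreMatrix p i j + legendreMatrix p j i = addLegendreSym (-1) (p i) * addLegendreSym (-1) (p j) :=
    fun i j hij => hrec_legendre p hp hp2 hinj i (mem_univ i) j (mem_univ j) hij
  have hy1 := Summit.BirchSwinnertonDyer.Rank1Residual.P2.AokiMonsky.sum_eps_eq_one_of_prod_mod_four p hodd h3
  have hrow := row_three_identity (fun i j => legendreMatrix p i j) (fun i => addLegendreSym (-1) (p i)) (fun i => addLegendreSym 2 (p i)) hrec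
    (D := univ) hy1 j
  rw [sconv_apply, sconv_apply, Finset.powerset_univ] at hrow
  simp only [spoint_apply, ← compl_eq_univ_sdiff] at hrow
  rw [Fintype.sum_congr _ _ (fun S => even_summand_eq p hp hodd hinj h3 S j), Fintype.sum_congr _ _ (fun T => odd_summand_eq p hp hodd hinj h3 T j),
    hrow, ← sum_mul_adjugate_monskyEven_inl_inr p, ← sum_mul_adjugate_monskyEven_inr_inl p,
    ← sum_neg_one_mul_adjugate_monskyEven_eq p hp hodd hinj h3, sum_single_mul, sum_single_mul, sum_pi_single', if_pos (mem_univ j), one_mul]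

include hp hodd hinj in
/-- **Row (iii) in census coordinates**: the `x_im`-bracket of the even square form is `Σ_j (A_j + A′_j + G) x_j`.
[cite: TianYuanZhang2017, §3.1, Thm. 3.6 (1)(2)] [cite: HeathBrown1994SelmerCongruentII, Appendix (Monsky), typescript p. 41 L20–L36] -/
theorem row_three_census (h3 : (∏ i, p i) % 4 = 3) (x : Fin k → ZMod 2) :
    (∑ S : Finset (Fin k), if (∏ i ∈ Sᶜ, p i) % 8 = 1 then blockWeightOdd p Sᶜ * ∑ j ∈ S, blockKappaSix p S j * x j else 0) +
      (∑ T : Finset (Fin k), if (∏ i ∈ T, p i) % 8 = 5 then chainCoeff p T * ∑ j ∈ T, QForm.blockRho p T j * x j else 0) =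
      ∑ j, ((monskyMatrixEven p).adjugate (Sum.inl j) (Sum.inr j) + (monskyMatrixEven p).adjugate (Sum.inr j) (Sum.inl j) +
        ∑ i, addLegendreSym (-1) (p i) * (monskyMatrixEven p).adjugate (Sum.inl i) (Sum.inr i)) * x j := by
  -- extend the inner sums to all `j` (the kernel sums vanish off the block) and exchange
  have hκ : ∀ S : Finset (Fin k), ∑ j ∈ S, blockKappaSix p S j * x j = ∑ j, blockKappaSix p S j * x j := fun S =>
    sum_subset (subset_univ S) fun j _ hj => by rw [blockKappaSix, dif_neg hj, zero_mul]
  have hρ : ∀ T : Finset (Fin k), ∑ j ∈ T, QForm.blockRho p T j * x j = ∑ j, QForm.blockRho p T j * x j := fun T =>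
    sum_subset (subset_univ T) fun j _ hj => by rw [QForm.blockRho, dif_neg hj, zero_mul]
  have hS : ∀ S : Finset (Fin k), (if (∏ i ∈ Sᶜ, p i) % 8 = 1 then blockWeightOdd p Sᶜ * ∑ j ∈ S, blockKappaSix p S j * x j else 0) =
      ∑ j, (if (∏ i ∈ Sᶜ, p i) % 8 = 1 then blockWeightOdd p Sᶜ * blockKappaSix p S j else 0) * x j := by
    intro S; rw [hκ]; split_ifs
    · rw [mul_sum]; exact sum_congr rfl fun j _ => by ring
    · simp
  have hT : ∀ T : Finset (Fin k), (if (∏ i ∈ T, p i) % 8 = 5 then chainCoeff p T * ∑ j ∈ T, QForm.blockRho p T j * x j else 0) =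
      ∑ j, (if (∏ i ∈ T, p i) % 8 = 5 then chainCoeff p T * QForm.blockRho p T j else 0) * x j := by
    intro T; rw [hρ]; split_ifs
    · rw [mul_sum]; exact sum_congr rfl fun j _ => by ring
    · simp
  rw [Fintype.sum_congr _ _ hS, Fintype.sum_congr _ _ hT]
  conv_lhs => arg 1; rw [Finset.sum_comm]
  conv_lhs => arg 2; rw [Finset.sum_comm]
  rw [← sum_add_distrib]
  refine Fintype.sum_congr _ _ fun j => ?_
  rw [← sum_mul, ← sum_mul, ← add_mul, row_three_coeff p hp hodd hinj h3 j]

include hp hodd hinj in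
/-- **The `(e_s, e_t)`-value of row (iv) through the dictionary**: with `Φ(s,t) = Σ_S [t ∈ S]·[d_{Sᶜ}≡1]·w_S κ^S_s + Σ_T [t ∈ T]·[d_T≡5]·c_T ρ^T_s`,
`Φ(s,t) + Φ(t,s) = A_s + A_t`. [cite: TianYuanZhang2017, §3.1, Thm. 3.6 (1)(2)] [cite: HeathBrown1994SelmerCongruentII, Appendix (Monsky), typescript p. 41 L20–L36]
[cite: Chaiken1982, §2] -/
theorem row_four_coeff (h3 : (∏ i, p i) % 4 = 3) (s t : Fin k) :
    ((∑ S : Finset (Fin k), if t ∈ S then (if (∏ i ∈ Sᶜ, p i) % 8 = 1 then blockWeightOdd p Sᶜ * blockKappaSix p S s else 0) else 0) +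
      ∑ T : Finset (Fin k), if t ∈ T then (if (∏ i ∈ T, p i) % 8 = 5 then chainCoeff p T * QForm.blockRho p T s else 0) else 0) +
    ((∑ S : Finset (Fin k), if s ∈ S then (if (∏ i ∈ Sᶜ, p i) % 8 = 1 then blockWeightOdd p Sᶜ * blockKappaSix p S t else 0) else 0) +
      ∑ T : Finset (Fin k), if s ∈ T then (if (∏ i ∈ T, p i) % 8 = 5 then chainCoeff p T * QForm.blockRho p T t else 0) else 0) =
      (monskyMatrixEven p).adjugate (Sum.inl s) (Sum.inr s) + (monskyMatrixEven p).adjugate (Sum.inl t) (Sum.inr t) := by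
  have hp2 : ∀ i, p i ≠ 2 := ne_two_of_odd p hodd
  have hrec : ∀ i j : Fin k, i ≠ j → legendreMatrix p i j + legendreMatrix p j i = addLegendreSym (-1) (p i) * addLegendreSym (-1) (p j) :=
    fun i j hij => hrec_legendre p hp hp2 hinj i (mem_univ i) j (mem_univ j) hij
  have hy1 := Summit.BirchSwinnertonDyer.Rank1Residual.P2.AokiMonsky.sum_eps_eq_one_of_prod_mod_four p hodd h3
  have hrow := row_four_identity (fun i j => legendreMatrix p i j) (fun i => addLegendreSym (-1) (p i)) (fun i => addLegendreSym 2 (p i)) hrec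
    (D := univ) hy1 s t
  rw [sconv_apply, sconv_apply, sconv_apply, sconv_apply, Finset.powerset_univ] at hrow
  simp only [spoint_apply, ← compl_eq_univ_sdiff, sum_pi_single', mem_univ, if_true, one_mul] at hrow
  rw [← sum_mul_adjugate_monskyEven_inl_inr p, ← sum_mul_adjugate_monskyEven_inl_inr p, sum_single_mul, sum_single_mul] at hrow
  -- the census summands
  have hev : ∀ (u v : Fin k) (S : Finset (Fin k)), (if v ∈ S then (if (∏ i ∈ Sᶜ, p i) % 8 = 1 then blockWeightOdd p Sᶜ * blockKappaSix p S u else 0)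
      else 0) = (∑ i ∈ S, addLegendreSym (-1) (p i)) * ((if v ∈ S then (1 : ZMod 2) else 0) *
        sconv (spoint (Pi.single u 1) (qwt (fun i j => legendreMatrix p i j) (fun i => addLegendreSym 2 (p i))))
          (setExp (qwt (fun i j => legendreMatrix p i j) (fun i => addLegendreSym (-1) (p i) + addLegendreSym 2 (p i)))) S) *
        setExp (fwt (fun i j => legendreMatrix p i j) (fun i => addLegendreSym (-1) (p i)) (fun i => addLegendreSym 2 (p i)) 0) Sᶜ := by
    intro u v S
    rw [even_summand_eq p hp hodd hinj h3 S u]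
    split_ifs <;> ring
  have hod : ∀ (u v : Fin k) (T : Finset (Fin k)), (if v ∈ T then (if (∏ i ∈ T, p i) % 8 = 5 then chainCoeff p T * QForm.blockRho p T u else 0)
      else 0) = (∑ i ∈ T, addLegendreSym 2 (p i)) * ((if v ∈ T then (1 : ZMod 2) else 0) *
        sconv (qwt (fun i j => legendreMatrix p i j) (Pi.single u 1)) (setExp (qwt (fun i j => legendreMatrix p i j) (fun i => addLegendreSym (-1) (p i)))) T) *
        sconv (fwt (fun i j => legendreMatrix p i j) (fun i => addLegendreSym (-1) (p i)) (fun i => addLegendreSym 2 (p i)) 0)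
          (setExp (fwt (fun i j => legendreMatrix p i j) (fun i => addLegendreSym (-1) (p i)) (fun i => addLegendreSym 2 (p i))
            (fun i => addLegendreSym 2 (p i)))) Tᶜ := by
    intro u v T
    rw [odd_summand_eq p hp hodd hinj h3 T u]
    split_ifs <;> ring
  simp only [hev, hod]
  rw [← hrow]
  ring

include hp hodd hinj in
/-- **Row (iv) in census coordinates**: the constant (in `x_im`, `x_2`) bracket of the even square form is `Σ_{a<b} (A_a + A_b) x_a x_b`.
[cite: TianYuanZhang2017, §3.1, Thm. 3.6 (1)(2)] [cite: HeathBrown1994SelmerCongruentII, Appendix (Monsky), typescript p. 41 L20–L36] -/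
theorem row_four_census (h3 : (∏ i, p i) % 4 = 3) (x : Fin k → ZMod 2) :
    (∑ S : Finset (Fin k), if (∏ i ∈ Sᶜ, p i) % 8 = 1 then
        blockWeightOdd p Sᶜ * ((1 + ∑ j ∈ S, x j) * ∑ j ∈ S, blockKappaSix p S j * x j) else 0) +
      (∑ T : Finset (Fin k), if (∏ i ∈ T, p i) % 8 = 5 then chainCoeff p T * ((1 + ∑ j ∈ T, x j) * ∑ j ∈ T, QForm.blockRho p T j * x j) else 0) =
      ∑ a, ∑ b, if a < b then ((monskyMatrixEven p).adjugate (Sum.inl a) (Sum.inr a) + (monskyMatrixEven p).adjugate (Sum.inl b) (Sum.inr b)) *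
        x a * x b else 0 := by
  have hsq : ∀ u : ZMod 2, u * u = u := by decide
  -- `Φ b a`: the census coefficient with kernel index `b` and membership condition `a`
  set Φ : Fin k → Fin k → ZMod 2 := fun b a =>
    (∑ S : Finset (Fin k), if a ∈ S then (if (∏ i ∈ Sᶜ, p i) % 8 = 1 then blockWeightOdd p Sᶜ * blockKappaSix p S b else 0) else 0) +
      ∑ T : Finset (Fin k), if a ∈ T then (if (∏ i ∈ T, p i) % 8 = 5 then chainCoeff p T * QForm.blockRho p T b else 0) else 0 with hΦ
  -- `(1 + ℓ_S) K_S = Σ_a Σ_{b ≠ a} [a ∈ S] x_a x_b κ^S_b` for a weight vanishing off `S`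
  have hquad : ∀ (S : Finset (Fin k)) (κ : Fin k → ZMod 2), (∀ j, j ∉ S → κ j = 0) →
      (1 + ∑ j ∈ S, x j) * ∑ j ∈ S, κ j * x j = ∑ a, ∑ b ∈ univ.erase a, x a * x b * ((if a ∈ S then (1 : ZMod 2) else 0) * κ b) := by
    intro S κ hκ
    have hext : ∑ j ∈ S, κ j * x j = ∑ j, κ j * x j := sum_subset (subset_univ S) fun j _ hj => by rw [hκ j hj, zero_mul]
    have hℓ : ∑ j ∈ S, x j = ∑ j, (if j ∈ S then (1 : ZMod 2) else 0) * x j := by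
      rw [show (∑ j, (if j ∈ S then (1 : ZMod 2) else 0) * x j) = ∑ j, (if j ∈ S then x j else 0) from
        Fintype.sum_congr _ _ fun j => by split_ifs <;> simp, ← sum_filter, filter_mem_eq_inter, univ_inter]
    rw [hext, hℓ, add_mul, one_mul, sum_mul]
    have ha : ∀ a, (if a ∈ S then (1 : ZMod 2) else 0) * x a * ∑ j, κ j * x j =
        (if a ∈ S then (1 : ZMod 2) else 0) * κ a * x a + ∑ b ∈ univ.erase a, x a * x b * ((if a ∈ S then (1 : ZMod 2) else 0) * κ b) := by
      intro a
      rw [mul_sum, ← add_sum_erase _ _ (mem_univ a)]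
      congr 1
      · rw [mul_assoc, show x a * (κ a * x a) = κ a * x a by rw [mul_left_comm, hsq], mul_assoc]
      · exact sum_congr rfl fun b _ => by ring
    rw [Fintype.sum_congr _ _ ha, sum_add_distrib]
    have hdiag : ∑ a, (if a ∈ S then (1 : ZMod 2) else 0) * κ a * x a = ∑ j, κ j * x j := by
      refine Fintype.sum_congr _ _ fun a => ?_
      by_cases haS : a ∈ S
      · rw [if_pos haS, one_mul]
      · rw [if_neg haS, hκ a haS]; ring
    rw [hdiag, ← add_assoc, CharTwo.add_self_eq_zero, zero_add]
  -- the left side is `Σ_a Σ_{b ≠ a} x_a x_b Φ(b,a)`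
  have hS : ∀ S : Finset (Fin k), (if (∏ i ∈ Sᶜ, p i) % 8 = 1 then
      blockWeightOdd p Sᶜ * ((1 + ∑ j ∈ S, x j) * ∑ j ∈ S, blockKappaSix p S j * x j) else 0) =
      ∑ a, ∑ b ∈ univ.erase a, x a * x b *
        (if a ∈ S then (if (∏ i ∈ Sᶜ, p i) % 8 = 1 then blockWeightOdd p Sᶜ * blockKappaSix p S b else 0) else 0) := by
    intro S
    rw [hquad S (fun b => blockKappaSix p S b) (fun j hj => by rw [blockKappaSix, dif_neg hj])]
    split_ifs with hc
    · rw [mul_sum]; refine Fintype.sum_congr _ _ fun a => ?_; rw [mul_sum]; refine sum_congr rfl fun b _ => ?_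
      split_ifs <;> ring
    · symm; refine Fintype.sum_eq_zero _ fun a => sum_eq_zero fun b _ => ?_; split_ifs <;> ring
  have hT : ∀ T : Finset (Fin k), (if (∏ i ∈ T, p i) % 8 = 5 then
      chainCoeff p T * ((1 + ∑ j ∈ T, x j) * ∑ j ∈ T, QForm.blockRho p T j * x j) else 0) =
      ∑ a, ∑ b ∈ univ.erase a, x a * x b *
        (if a ∈ T then (if (∏ i ∈ T, p i) % 8 = 5 then chainCoeff p T * QForm.blockRho p T b else 0) else 0) := by
    intro T
    rw [hquad T (fun b => QForm.blockRho p T b) (fun j hj => by rw [QForm.blockRho, dif_neg hj])]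
    split_ifs with hc
    · rw [mul_sum]; refine Fintype.sum_congr _ _ fun a => ?_; rw [mul_sum]; refine sum_congr rfl fun b _ => ?_
      split_ifs <;> ring
    · symm; refine Fintype.sum_eq_zero _ fun a => sum_eq_zero fun b _ => ?_; split_ifs <;> ring
  have hL : (∑ S : Finset (Fin k), if (∏ i ∈ Sᶜ, p i) % 8 = 1 then
        blockWeightOdd p Sᶜ * ((1 + ∑ j ∈ S, x j) * ∑ j ∈ S, blockKappaSix p S j * x j) else 0) +
      (∑ T : Finset (Fin k), if (∏ i ∈ T, p i) % 8 = 5 then chainCoeff p T * ((1 + ∑ j ∈ T, x j) * ∑ j ∈ T, QForm.blockRho p T j * x j) else 0) =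
      ∑ a, ∑ b ∈ univ.erase a, x a * x b * Φ b a := by
    rw [Fintype.sum_congr _ _ hS, Fintype.sum_congr _ _ hT]
    conv_lhs => arg 1; rw [Finset.sum_comm]
    conv_lhs => arg 2; rw [Finset.sum_comm]
    rw [← sum_add_distrib]
    refine Fintype.sum_congr _ _ fun a => ?_
    rw [Finset.sum_comm, Finset.sum_comm (s := (univ : Finset (Finset (Fin k)))), ← sum_add_distrib]
    refine sum_congr rfl fun b _ => ?_
    rw [← mul_sum, ← mul_sum, ← mul_add]
  -- the right side is the same, by row (iv)
  have hR : (∑ a, ∑ b, if a < b then ((monskyMatrixEven p).adjugate (Sum.inl a) (Sum.inr a) +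
      (monskyMatrixEven p).adjugate (Sum.inl b) (Sum.inr b)) * x a * x b else 0) = ∑ a, ∑ b ∈ univ.erase a, x a * x b * Φ b a := by
    have hab : ∀ a b : Fin k, (if a < b then ((monskyMatrixEven p).adjugate (Sum.inl a) (Sum.inr a) +
        (monskyMatrixEven p).adjugate (Sum.inl b) (Sum.inr b)) * x a * x b else 0) =
        (if a < b then x a * x b * Φ a b else 0) + (if a < b then x a * x b * Φ b a else 0) := by
      intro a b
      have hc := row_four_coeff p hp hodd hinj h3 a b
      split_ifs
      · rw [← hc]; ring
      · rw [add_zero]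
    simp only [hab, sum_add_distrib]
    -- swap the summation variables in the first family
    rw [Finset.sum_comm (f := fun a b => if a < b then x a * x b * Φ a b else 0), ← sum_add_distrib]
    refine Fintype.sum_congr _ _ fun a => ?_
    rw [← sum_add_distrib, ← Finset.sum_erase_add _ _ (mem_univ a)]
    simp only [lt_self_iff_false, if_false, add_zero]
    refine sum_congr rfl fun b hb => ?_
    rcases lt_or_gt_of_ne (ne_of_mem_erase hb) with h | h
    · simp only [h, not_lt.mpr h.le, if_true, if_false, add_zero]; ring
    · simp only [h, not_lt.mpr h.le, if_true, if_false, zero_add]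
  rw [hL, hR]

/-! ## §4 The even Ω-identity -/

include hp hodd hinj in
/-- **THE EVEN Ω-IDENTITY (LEAD g13's research statement `EvenOmegaMatrixIdentity`), PROVED**: for a tuple of distinct odd primes with
`∏ pᵢ ≡ 3 (mod 4)` and every bit vector `(x_im, x_2, x)`, `evenSquareFormMatrix p x_im x_2 x = evenOmegaFormMatrix p x_im x_2 x` — the square
motion of every Galois element on Tian–Yuan–Zhang's genus point `P(n)`, `n = 2p₁⋯p_k ≡ 6 (mod 8)`, read through the block laws (LEAD g13,
`…EvenSquareFormMatrixBridge`), is the explicit quadratic form in the adjugate of Monsky's even matrix.  Proof: the four coefficient rows (§2–§3).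
[cite: TianYuanZhang2017, Thm. 1.1, §3.1, Prop. 3.2 (2), Thm. 3.6 (1)(2), proof of Lemma 3.21] [cite: HeathBrown1994SelmerCongruentII, Appendix (Monsky), typescript p. 39 L10 – p. 41 L36]
[cite: Chaiken1982, §2] [cite: Smith2016CongruentDensity, §2.2] -/
theorem evenSquareFormMatrix_eq_evenOmegaFormMatrix (h3 : (∏ i, p i) % 4 = 3) (xim x2 : ZMod 2) (x : Fin k → ZMod 2) :
    evenSquareFormMatrix p xim x2 x = evenOmegaFormMatrix p xim x2 x := by
  rw [evenSquareFormMatrix_expand, row_two_census p hp hodd hinj h3, row_one_census p hp hodd hinj h3, row_three_census p hp hodd hinj h3,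
    row_four_census p hp hodd hinj h3]
  simp only [evenOmegaFormMatrix]

omit hp hodd hinj in
/-- **`EvenOmegaMatrixIdentity` in the quantifier shape of the crux workfile `Lines/offtyz_v7_EvenOmega.lean`.**
[cite: TianYuanZhang2017, Thm. 1.1, §3.1, Thm. 3.6 (1)(2)] [cite: HeathBrown1994SelmerCongruentII, Appendix (Monsky), typescript p. 39 L10 – p. 41 L36] -/
theorem evenOmegaMatrixIdentity_holds : ∀ (k : ℕ) (p : Fin k → ℕ), (∀ i, (p i).Prime) → (∀ i, Odd (p i)) → Function.Injective p →
    (∏ i, p i) % 4 = 3 → ∀ (xim x2 : ZMod 2) (x : Fin k → ZMod 2), evenSquareFormMatrix p xim x2 x = evenOmegaFormMatrix p xim x2 x :=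
  fun _ p hp hodd hinj h3 xim x2 x => evenSquareFormMatrix_eq_evenOmegaFormMatrix p hp hodd hinj h3 xim x2 x

end Identity

end Summit.BirchSwinnertonDyer.PrintCf2.QFormForest

/-! ## §5 Consequences: the two conditional consumers, discharged -/
namespace Summit.BirchSwinnertonDyer.PrintCf2.MoverAssembly

open WeierstrassCurve WeierstrassCurve.Affine Literature.NumberTheory.EllipticCurves Literature.NumberTheory.EllipticCurves.TianYuanZhang2017
  Summit.BirchSwinnertonDyer.PrintCf2.QFormForest

variable {k : ℕ} (p : Fin k → ℕ) (hp : ∀ i, (p i).Prime) (hodd : ∀ i, Odd (p i)) (hinj : Function.Injective p) {n : ℕ}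

include hp hodd hinj in
/-- **THE LOWER HALF OF C⁺ ON THE WHOLE EVEN JUMP-ONE CLASS, ALL `k`, MODULO THE PRINTED FACTS** (`n = 2∏pᵢ` square-free, `∏pᵢ ≡ 3 (4)`,
`#Sel₂ = 2^{2+s}`, `s ≥ 2`, `r_an = 1`, generator with `x ∉ ⟨−1,2,n⟩ℚ^{×2}` ⟹ `2 ∣ 𝓛(n)`). [cite: TianYuanZhang2017, Thm. 1.1, §3] [cite: Darmon2004, Thm. 3.22] -/
theorem two_dvd_scriptL_even_allk_of_facts
    (hF : tyz_cmPointRingClassFrobeniusValueData ∧ thm11_parity_of_scriptL ∧ rank_eq_analyticRank_of_analyticRank_le_one)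
    (hn : n = 2 * ∏ i, p i) (h3 : (∏ i, p i) % 4 = 3) (hsq : Squarefree n)
    {s : ℕ} (hs : 2 ≤ s) (hsel : Nat.card ((congruentNumberCurve n).selmerGroup 2) = 2 ^ (2 + s))
    (hra : haveI := isElliptic_congruentNumberCurve hsq.ne_zero; (congruentNumberCurve n).analyticRank = 1)
    {x y : ℚ} (hxy : (congruentNumberCurve n).toAffine.Nonsingular x y)
    (hgen : haveI := isElliptic_congruentNumberCurve hsq.ne_zero;
      ∀ P, ∃ m : ℤ, IsOfFinAddOrder (P - m • (Point.some x y hxy : (congruentNumberCurve n).toAffine.Point)))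
    (hx : ¬ ∃ r : ℚ, x = r ^ 2 ∨ x = -r ^ 2 ∨ x = n * r ^ 2 ∨ x = -(n * r ^ 2))
    (hx2 : ¬ ∃ r : ℚ, x = 2 * r ^ 2 ∨ x = -(2 * r ^ 2) ∨ x = 2 * n * r ^ 2 ∨ x = -(2 * n * r ^ 2)) :
    ∀ L : ℤ, IsScriptL n L → (2 : ℤ) ∣ L :=
  two_dvd_scriptL_even_of_evenOmega_of_facts p hp hodd hinj hF (evenSquareFormMatrix_eq_evenOmegaFormMatrix p hp hodd hinj h3)
    hn h3 hsq hs hsel hra hxy hgen hx hx2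

include hp hodd hinj in
/-- **`#Sel₂(E_n) = 8 ⟹ ord = rank = 1 ∧ Ш[2^∞] = 0 ∧ BSD(E_n, 2)` FOR EVERY SQUARE-FREE `n ≡ 6 (mod 8)`, MODULO THE PRINTED FACTS** (Smith's `S(6)`,
100 %). [cite: TianYuanZhang2017, Thm. 1.1, Thm. 3.5, §3] [cite: HeathBrown1994SelmerCongruentII, Appendix (Monsky)] [cite: Miller2011LMS, Def. 1.1] -/
theorem selmerEight_six_bsdp_two_allk_of_facts (hF : tyz_cmPointRingClassFrobeniusValueData ∧ thm11_parity_of_scriptL)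
    (hn : n = 2 * ∏ i, p i) (h3 : (∏ i, p i) % 4 = 3) (hsq : Squarefree n)
    (hsel : haveI := isElliptic_congruentNumberCurve hsq.ne_zero; Nat.card ((congruentNumberCurve n).selmerGroup 2) = 8) :
    haveI := isElliptic_congruentNumberCurve hsq.ne_zero
    (congruentNumberCurve n).analyticRank = 1 ∧ (congruentNumberCurve n).mordellWeilRank = 1 ∧
      AddCommGroup.primaryComponent (congruentNumberCurve n).sha 2 = ⊥ ∧ BSDp (congruentNumberCurve n) 2 :=
  selmerEight_six_bsdp_two_of_evenOmega_of_facts p hp hodd hinj hF (evenSquareFormMatrix_eq_evenOmegaFormMatrix p hp hodd hinj h3) hn h3 hsq hsel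

end Summit.BirchSwinnertonDyer.PrintCf2.MoverAssembly

end
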